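/-
Copyright: statement-level skeleton of a published paper (lit-balaban cell, Phase-2 proof seat p32 gen 42). No claims beyond
what the kernel checks below.
-/
import Literature.MathematicalPhysics.QuantumFieldTheory.Balaban1983to89.B3OnePIChainPieces
import Literature.MathematicalPhysics.QuantumFieldTheory.Balaban1983to89.B3GraphGlue

/-!
# B3 — T. Bałaban, *(Higgs)₂,₃ quantum fields in a finite volume. III. Renormalization*, CMP **88** (1983) 411–445
[Balaban1983Higgs3] — p. 416 [PDF 6] (1.21): «DECOMPOSE ∘ GLUE» — the chain invariants (separating lines, near legs, `numSep`,
`level`) of p37's glued graph `B3GraphGlue.glue G₁ G₂ a b` computed from those of the two pieces: gluing two connected graphs by one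
new propagator line CONCATENATES their chains (the new line is the extra separating line; the levels of the second piece are
shifted by `numSep G₁ + 1`)

statement-level skeleton of published theorems with citation tags; proofs where landed; nothing here is a claim about
the Yang–Mills mass gap

PDF held: `paper:balaban1983-higgs-2-3-quantum-fields-finite-volume` (journal page = PDF page + 410); p. 415 L28–31, p. 416 L13–18
re-read this session (text layer; ×2 renders `…/1983-cmp88-higgs23-III-p005, p006-x2.png`).

CITATION HEADER (lean-in-tree rule).  lit-balaban TYPED SKELETON (HOME `run/shared/lean/pub/lit-balaban/`), PHASE 2, seat p32
gen 42 (unit `lit-balaban-p32`; TAKING #2 line HOME/STATUS.md 2026-08-23T11:33Z), row **B3.Eq1.19-1.22** of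
`HOME/lit-balaban-r15/ROWS-B3.md` (fold owner r15, referee ref-4; head `proved` under the lead g12 HEAD WORD Q25, reading (P); this
file is an OPTIONAL located member of the (1.21) cell, zero head weight).  It joins the two halves of the graph side of (1.21):
the ANALYSIS (same seat: `B3OnePIChainDecomposition` — `Sep`, `IsNear`, `nearLegs`, `numSep`, `beyond`, `level`; `B3OnePIChainPieces`)
and the SYNTHESIS (p37 g106: `B3GraphGlueLegs.legL`/`legR`/`glueOther…`, `B3GraphGlue.glue`, `glue_other`, `isConnected_glue`,
`not_reflTransGen_adjOff_glue`), all REUSED BY NAME; nothing re-declared; no definition added.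

THE PRINTED TEXT (verbatim).  p. 416: *"The function G^ε has a perturbative expansion of the following structure
G^ε = Σ_{n=0}^∞ C₀^ε[(−δm² + Σ^ε + ∂^{ε*}Σ₁^ε + Σ₁^{ε*}∂^ε + ∂^{ε*}Σ₂^ε∂^ε)C₀^ε]ⁿ, (1.21) where C₀^ε = (−Δ₀^ε + m²)^{−1} and Σ^ε, Σ₁^ε, Σ₂^ε
are given by amputated, one-particle-irreducible graphs of the expansion of G^ε."*  (The n-th term joins n insertions by n − 1
propagator lines; print states the structure without proof.  Here: joining by one line adds exactly one separating line and
concatenates the pieces — the step that, iterated, identifies p37's `B3OnePIChainGlue.chain` terms with chains of given length.)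

WHAT IS PROVED (theorems only; no definition, no `Prop` fact, no `sorry`; standard axioms).  Throughout `G := glue G₁ G₂ a b ha hb hab`
(`a`, `b` external legs of `G₁`, `G₂` of one species), roots `I := Fin.castAdd G₂.nV i` (a vertex `i` of `G₁`) and
`J := Fin.natAdd G₁.nV j` (a vertex `j` of `G₂`); `legL x` / `legR y` = the legs of `G₁` / `G₂` seen in `G`.
* §1 CUT ADJACENCY IN THE GLUED GRAPH: `adjOff_glue_left` / `adjOff_glue_right` / `adjOff_glue_new` (old lines and the new line
  survive any cut other than their own), `adjOff_glue_legL_cases` / `adjOff_glue_legR_cases` (nothing else survives), projections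
  `proj_left_adjOff` / `proj_left_reflTransGen` (collapse `G₂` to `a.1` under a cut at `legL x`) and `proj_right_adjOff` /
  `proj_right_reflTransGen` (collapse `G₁` to `b.1` under a cut at `legR y`) after p37's `proj_left_adj`, liftings `lift_left` /
  `lift_left_adjOff` / `lift_right` / `lift_right_adjOff`;
* §2 SEPARATION: **`sep_glue_legL_iff`** (`Sep G I J (legL x) ↔ Sep G₁ i a.1 x` for `x ≠ a`, `G₂` connected), **`sep_glue_legR_iff`**
  (`↔ Sep G₂ b.1 j y` for `y ≠ b`, `G₁` connected), **`isNear_glue_new`** (the new line separates — p37 — with near leg `legL a`),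
  `not_isNear_glue_legR_b`, `isNear_glue_legL_iff`, `isNear_glue_legR_iff`, **`mem_nearLegs_glue`** / `nearLegs_glue`
  (`nearLegs G I J = insert (legL a) (map legL (nearLegs G₁ i a.1) ∪ map legR (nearLegs G₂ b.1 j))`), **`numSep_glue`**:
  `numSep G I J = numSep G₁ i a.1 + numSep G₂ b.1 j + 1`;
* §3 LEVELS: **`level_glue_left`** (`level G I J (castAdd v) = level G₁ i a.1 v`), **`level_glue_right`**
  (`level G I J (natAdd w) = numSep G₁ i a.1 + 1 + level G₂ b.1 j w`);
* §4 **`chain_glue`** (packaged: gluing concatenates the chains — ports `a.1` ↦ level `numSep G₁ i a.1`, `b.1` ↦ that `+ 1`) and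
  **`chain_glue_of_one_piece`** (two one-piece graphs glue to a two-piece chain whose only separating line is the new one: the
  `n = 2` term `C₀ K₁ C₀ K₂ C₀`).
HONEST SCOPE.  Invariants only (which lines separate, near legs, `numSep`, `level`); connectedness of both pieces is assumed where
the lift through the other piece is used; no isomorphism «decompose ∘ glue = id» between sub-graph OBJECTS (the pieces are still
level sets, not `Graph n̄` structures); the iteration over p37's list-recursive `B3OnePIChainGlue.chain` is not carried out here;
nothing analytic, no amplitude.
-/

namespace Literature.MathematicalPhysics.QuantumFieldTheory.Balaban1983to89.B3OnePIChainGlueLevels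

open Relation Finset B3Prop1 B3Cor23Concrete B3OnePIGraphs B3OnePIBridge B3OnePIChainDecomposition B3OnePIChainPieces
  B3GraphGlueLegs B3GraphGlue

variable {nbar : ℕ} {G₁ G₂ : Graph nbar} {a : Leg G₁.kind} {b : Leg G₂.kind} {ha : G₁.other a = none}
  {hb : G₂.other b = none} {hab : a.2.isLeft = b.2.isLeft}

/-! ## §1 Cutting a line of the glued graph: the three kinds of surviving adjacencies; liftings and projections -/

/-- kernel: an internal line of the first piece, both of whose legs differ from the cut leg `c`, is an adjacency of the glued
graph surviving the cut at `c`. [cite: Balaban1983Higgs3, (1.21) p.416] -/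
theorem adjOff_glue_left {x₀ x₀' : Leg G₁.kind} (hx : G₁.other x₀ = some x₀') {c : Leg (Fin.append G₁.kind G₂.kind)}
    (h₁ : c ≠ legL G₁.kind G₂.kind x₀) (h₂ : c ≠ legL G₁.kind G₂.kind x₀') :
    AdjOff (glue G₁ G₂ a b ha hb hab) c (Fin.castAdd G₂.nV x₀.1) (Fin.castAdd G₂.nV x₀'.1) := by
  have hx₀a : x₀ ≠ a := by
    rintro rfl
    rw [ha] at hx
    cases hx
  refine adjOffOf_iff.2 ⟨legL _ _ x₀, legL _ _ x₀', ?_, h₁.symm, h₂.symm, rfl, rfl⟩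
  show glueOther G₁.other G₂.other a b (legL _ _ x₀) = some (legL _ _ x₀')
  rw [glueOther_legL_of_ne hx₀a, hx]
  rfl

/-- kernel: the same for an internal line of the second piece. [cite: Balaban1983Higgs3, (1.21) p.416] -/
theorem adjOff_glue_right {y₀ y₀' : Leg G₂.kind} (hy : G₂.other y₀ = some y₀') {c : Leg (Fin.append G₁.kind G₂.kind)}
    (h₁ : c ≠ legR G₁.kind G₂.kind y₀) (h₂ : c ≠ legR G₁.kind G₂.kind y₀') :
    AdjOff (glue G₁ G₂ a b ha hb hab) c (Fin.natAdd G₁.nV y₀.1) (Fin.natAdd G₁.nV y₀'.1) := by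
  have hy₀b : y₀ ≠ b := by
    rintro rfl
    rw [hb] at hy
    cases hy
  refine adjOffOf_iff.2 ⟨legR _ _ y₀, legR _ _ y₀', ?_, h₁.symm, h₂.symm, rfl, rfl⟩
  show glueOther G₁.other G₂.other a b (legR _ _ y₀) = some (legR _ _ y₀')
  rw [glueOther_legR_of_ne hy₀b, hy]
  rfl

/-- kernel: the new line is an adjacency surviving any cut other than its own. [cite: Balaban1983Higgs3, (1.21) p.416] -/
theorem adjOff_glue_new {c : Leg (Fin.append G₁.kind G₂.kind)} (h₁ : c ≠ legL G₁.kind G₂.kind a)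
    (h₂ : c ≠ legR G₁.kind G₂.kind b) :
    AdjOff (glue G₁ G₂ a b ha hb hab) c (Fin.castAdd G₂.nV a.1) (Fin.natAdd G₁.nV b.1) := by
  refine adjOffOf_iff.2 ⟨legL _ _ a, legR _ _ b, ?_, h₁.symm, h₂.symm, rfl, rfl⟩
  show glueOther G₁.other G₂.other a b (legL _ _ a) = some (legR _ _ b)
  rw [glueOther_legL_self]

/-- kernel: the adjacencies of the glued graph surviving the cut at an embedded leg `legL x` of the first piece — an old line of
the first piece avoiding `x`, or any old line of the second piece, or (if `x ≠ a`) the new line.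
[cite: Balaban1983Higgs3, (1.21) p.416] -/
theorem adjOff_glue_legL_cases {x : Leg G₁.kind} {v w : Fin (G₁.nV + G₂.nV)}
    (h : AdjOff (glue G₁ G₂ a b ha hb hab) (legL G₁.kind G₂.kind x) v w) :
    (∃ i i', v = Fin.castAdd G₂.nV i ∧ w = Fin.castAdd G₂.nV i' ∧ AdjOff G₁ x i i') ∨
    (∃ j j', v = Fin.natAdd G₁.nV j ∧ w = Fin.natAdd G₁.nV j' ∧ Adj G₂ j j') ∨
    (x ≠ a ∧ ((v = Fin.castAdd G₂.nV a.1 ∧ w = Fin.natAdd G₁.nV b.1) ∨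
      (v = Fin.natAdd G₁.nV b.1 ∧ w = Fin.castAdd G₂.nV a.1))) := by
  obtain ⟨z, z', hzz', hz, hz', rfl, rfl⟩ := adjOffOf_iff.1 h
  rw [glue_other] at hzz'
  rcases exists_legL_or_legR G₁.kind G₂.kind z with ⟨x₀, rfl⟩ | ⟨y₀, rfl⟩
  · by_cases hx₀ : x₀ = a
    · subst hx₀
      rw [glueOther_legL_self] at hzz'
      cases hzz'
      exact Or.inr (Or.inr ⟨fun e => hz (by rw [e]), Or.inl ⟨rfl, rfl⟩⟩)
    · rw [glueOther_legL_of_ne hx₀] at hzz'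
      obtain ⟨x₀', hx₀', rfl⟩ := Option.map_eq_some_iff.1 hzz'
      refine Or.inl ⟨x₀.1, x₀'.1, rfl, rfl, adjOffOf_iff.2 ⟨x₀, x₀', hx₀', ?_, ?_, rfl, rfl⟩⟩
      · exact fun e => hz (by rw [e])
      · exact fun e => hz' (by rw [e])
  · by_cases hy₀ : y₀ = b
    · subst hy₀
      rw [glueOther_legR_self] at hzz'
      cases hzz'
      exact Or.inr (Or.inr ⟨fun e => hz' (by rw [e]), Or.inr ⟨rfl, rfl⟩⟩)
    · rw [glueOther_legR_of_ne hy₀] at hzz'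
      obtain ⟨y₀', hy₀', rfl⟩ := Option.map_eq_some_iff.1 hzz'
      exact Or.inr (Or.inl ⟨y₀.1, y₀'.1, rfl, rfl, adj_iff.2 ⟨y₀, y₀', hy₀', rfl, rfl⟩⟩)

/-- kernel: the adjacencies surviving the cut at an embedded leg `legR y` of the second piece (mirror of the previous lemma).
[cite: Balaban1983Higgs3, (1.21) p.416] -/
theorem adjOff_glue_legR_cases {y : Leg G₂.kind} {v w : Fin (G₁.nV + G₂.nV)}
    (h : AdjOff (glue G₁ G₂ a b ha hb hab) (legR G₁.kind G₂.kind y) v w) :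
    (∃ i i', v = Fin.castAdd G₂.nV i ∧ w = Fin.castAdd G₂.nV i' ∧ Adj G₁ i i') ∨
    (∃ j j', v = Fin.natAdd G₁.nV j ∧ w = Fin.natAdd G₁.nV j' ∧ AdjOff G₂ y j j') ∨
    (y ≠ b ∧ ((v = Fin.castAdd G₂.nV a.1 ∧ w = Fin.natAdd G₁.nV b.1) ∨
      (v = Fin.natAdd G₁.nV b.1 ∧ w = Fin.castAdd G₂.nV a.1))) := by
  obtain ⟨z, z', hzz', hz, hz', rfl, rfl⟩ := adjOffOf_iff.1 h
  rw [glue_other] at hzz'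
  rcases exists_legL_or_legR G₁.kind G₂.kind z with ⟨x₀, rfl⟩ | ⟨y₀, rfl⟩
  · by_cases hx₀ : x₀ = a
    · subst hx₀
      rw [glueOther_legL_self] at hzz'
      cases hzz'
      exact Or.inr (Or.inr ⟨fun e => hz' (by rw [e]), Or.inl ⟨rfl, rfl⟩⟩)
    · rw [glueOther_legL_of_ne hx₀] at hzz'
      obtain ⟨x₀', hx₀', rfl⟩ := Option.map_eq_some_iff.1 hzz'
      exact Or.inl ⟨x₀.1, x₀'.1, rfl, rfl, adj_iff.2 ⟨x₀, x₀', hx₀', rfl, rfl⟩⟩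
  · by_cases hy₀ : y₀ = b
    · subst hy₀
      rw [glueOther_legR_self] at hzz'
      cases hzz'
      exact Or.inr (Or.inr ⟨fun e => hz (by rw [e]), Or.inr ⟨rfl, rfl⟩⟩)
    · rw [glueOther_legR_of_ne hy₀] at hzz'
      obtain ⟨y₀', hy₀', rfl⟩ := Option.map_eq_some_iff.1 hzz'
      refine Or.inr (Or.inl ⟨y₀.1, y₀'.1, rfl, rfl, adjOffOf_iff.2 ⟨y₀, y₀', hy₀', ?_, ?_, rfl, rfl⟩⟩)
      · exact fun e => hz (by rw [e])
      · exact fun e => hz' (by rw [e])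

/-- kernel (projection onto the first piece under a cut at `legL x`): collapsing the second piece to the vertex of `a` maps a
surviving adjacency to equal vertices or to an adjacency of `G₁` surviving the cut at `x`. [cite: Balaban1983Higgs3, (1.21) p.416] -/
theorem proj_left_adjOff {x : Leg G₁.kind} {v w : Fin (G₁.nV + G₂.nV)}
    (h : AdjOff (glue G₁ G₂ a b ha hb hab) (legL G₁.kind G₂.kind x) v w) :
    ReflTransGen (AdjOff G₁ x) (Fin.addCases (fun i => i) (fun _ => a.1) v) (Fin.addCases (fun i => i) (fun _ => a.1) w) := by
  rcases adjOff_glue_legL_cases h with ⟨i, i', rfl, rfl, hi⟩ | ⟨j, j', rfl, rfl, -⟩ | ⟨-, ⟨rfl, rfl⟩ | ⟨rfl, rfl⟩⟩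
  · simpa using ReflTransGen.single hi
  all_goals simp only [Fin.addCases_left, Fin.addCases_right]; exact ReflTransGen.refl

/-- kernel: … hence a path of the glued graph avoiding `legL x` projects to a path of `G₁` avoiding `x`.
[cite: Balaban1983Higgs3, (1.21) p.416] -/
theorem proj_left_reflTransGen {x : Leg G₁.kind} {v w : Fin (G₁.nV + G₂.nV)}
    (h : ReflTransGen (AdjOff (glue G₁ G₂ a b ha hb hab) (legL G₁.kind G₂.kind x)) v w) :
    ReflTransGen (AdjOff G₁ x) (Fin.addCases (fun i => i) (fun _ => a.1) v) (Fin.addCases (fun i => i) (fun _ => a.1) w) := by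
  induction h with
  | refl => exact ReflTransGen.refl
  | tail _ hcd ih => exact ih.trans (proj_left_adjOff hcd)

/-- kernel (projection onto the second piece under a cut at `legR y`). [cite: Balaban1983Higgs3, (1.21) p.416] -/
theorem proj_right_adjOff {y : Leg G₂.kind} {v w : Fin (G₁.nV + G₂.nV)}
    (h : AdjOff (glue G₁ G₂ a b ha hb hab) (legR G₁.kind G₂.kind y) v w) :
    ReflTransGen (AdjOff G₂ y) (Fin.addCases (fun _ => b.1) (fun j => j) v) (Fin.addCases (fun _ => b.1) (fun j => j) w) := by
  rcases adjOff_glue_legR_cases h with ⟨i, i', rfl, rfl, -⟩ | ⟨j, j', rfl, rfl, hj⟩ | ⟨-, ⟨rfl, rfl⟩ | ⟨rfl, rfl⟩⟩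
  · simp only [Fin.addCases_left]; exact ReflTransGen.refl
  · simpa using ReflTransGen.single hj
  all_goals simp only [Fin.addCases_left, Fin.addCases_right]; exact ReflTransGen.refl

/-- kernel: … hence a path of the glued graph avoiding `legR y` projects to a path of `G₂` avoiding `y`.
[cite: Balaban1983Higgs3, (1.21) p.416] -/
theorem proj_right_reflTransGen {y : Leg G₂.kind} {v w : Fin (G₁.nV + G₂.nV)}
    (h : ReflTransGen (AdjOff (glue G₁ G₂ a b ha hb hab) (legR G₁.kind G₂.kind y)) v w) :
    ReflTransGen (AdjOff G₂ y) (Fin.addCases (fun _ => b.1) (fun j => j) v) (Fin.addCases (fun _ => b.1) (fun j => j) w) := by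
  induction h with
  | refl => exact ReflTransGen.refl
  | tail _ hcd ih => exact ih.trans (proj_right_adjOff hcd)

/-- kernel (lifting a path of the first piece): a path of `G₁` is a path of the glued graph avoiding any cut leg `c` that is not a
leg of an internal line of the first piece. [cite: Balaban1983Higgs3, (1.21) p.416] -/
theorem lift_left {c : Leg (Fin.append G₁.kind G₂.kind)} (hc : ∀ x₀, (G₁.other x₀).isSome → c ≠ legL G₁.kind G₂.kind x₀)
    {i i' : Fin G₁.nV} (h : ReflTransGen (Adj G₁) i i') :
    ReflTransGen (AdjOff (glue G₁ G₂ a b ha hb hab) c) (Fin.castAdd G₂.nV i) (Fin.castAdd G₂.nV i') := by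
  induction h with
  | refl => exact ReflTransGen.refl
  | tail _ hcd ih =>
      obtain ⟨x₀, x₀', hx, rfl, rfl⟩ := adj_iff.1 hcd
      exact ih.tail (adjOff_glue_left hx (hc x₀ (by simp [hx])) (hc x₀' (by simp [G₁.other_symm _ _ hx])))

/-- kernel (lifting a path of the first piece avoiding `x`): it is a path of the glued graph avoiding `legL x`.
[cite: Balaban1983Higgs3, (1.21) p.416] -/
theorem lift_left_adjOff {x : Leg G₁.kind} {i i' : Fin G₁.nV} (h : ReflTransGen (AdjOff G₁ x) i i') :
    ReflTransGen (AdjOff (glue G₁ G₂ a b ha hb hab) (legL G₁.kind G₂.kind x)) (Fin.castAdd G₂.nV i)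
      (Fin.castAdd G₂.nV i') := by
  induction h with
  | refl => exact ReflTransGen.refl
  | tail _ hcd ih =>
      obtain ⟨x₀, x₀', hx, hx₀, hx₀', rfl, rfl⟩ := adjOffOf_iff.1 hcd
      exact ih.tail (adjOff_glue_left hx (fun e => hx₀ (legL_injective _ _ e).symm)
        (fun e => hx₀' (legL_injective _ _ e).symm))

/-- kernel (lifting a path of the second piece). [cite: Balaban1983Higgs3, (1.21) p.416] -/
theorem lift_right {c : Leg (Fin.append G₁.kind G₂.kind)} (hc : ∀ y₀, (G₂.other y₀).isSome → c ≠ legR G₁.kind G₂.kind y₀)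
    {j j' : Fin G₂.nV} (h : ReflTransGen (Adj G₂) j j') :
    ReflTransGen (AdjOff (glue G₁ G₂ a b ha hb hab) c) (Fin.natAdd G₁.nV j) (Fin.natAdd G₁.nV j') := by
  induction h with
  | refl => exact ReflTransGen.refl
  | tail _ hcd ih =>
      obtain ⟨y₀, y₀', hy, rfl, rfl⟩ := adj_iff.1 hcd
      exact ih.tail (adjOff_glue_right hy (hc y₀ (by simp [hy])) (hc y₀' (by simp [G₂.other_symm _ _ hy])))

/-- kernel (lifting a path of the second piece avoiding `y`). [cite: Balaban1983Higgs3, (1.21) p.416] -/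
theorem lift_right_adjOff {y : Leg G₂.kind} {j j' : Fin G₂.nV} (h : ReflTransGen (AdjOff G₂ y) j j') :
    ReflTransGen (AdjOff (glue G₁ G₂ a b ha hb hab) (legR G₁.kind G₂.kind y)) (Fin.natAdd G₁.nV j)
      (Fin.natAdd G₁.nV j') := by
  induction h with
  | refl => exact ReflTransGen.refl
  | tail _ hcd ih =>
      obtain ⟨y₀, y₀', hy, hy₀, hy₀', rfl, rfl⟩ := adjOffOf_iff.1 hcd
      exact ih.tail (adjOff_glue_right hy (fun e => hy₀ (legR_injective _ _ e).symm)
        (fun e => hy₀' (legR_injective _ _ e).symm))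

/-! ## §2 Which lines of the glued graph separate the roots; the near legs; `numSep` adds up -/

section Roots

variable (i : Fin G₁.nV) (j : Fin G₂.nV)

/-- kernel: `a` is not on a separating line of `G₁` (it is external there). [cite: Balaban1983Higgs3, (1.21) p.416] -/
theorem not_sep_a {i₀ i₁ : Fin G₁.nV} (ha : G₁.other a = none) : ¬ Sep G₁ i₀ i₁ a := by
  rintro ⟨h, -⟩
  rw [ha] at h
  exact Bool.false_ne_true h

/-- kernel: `b` is not on a separating line of `G₂`. [cite: Balaban1983Higgs3, (1.21) p.416] -/
theorem not_sep_b {j₀ j₁ : Fin G₂.nV} (hb : G₂.other b = none) : ¬ Sep G₂ j₀ j₁ b := by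
  rintro ⟨h, -⟩
  rw [hb] at h
  exact Bool.false_ne_true h

/-- **the roots stay joined after cutting an old line of the first piece iff `i` stays joined to the port `a.1` in `G₁`**
(second piece connected). [cite: Balaban1983Higgs3, (1.21) p.416] -/
theorem reach_glue_legL_iff (hG₂ : IsConnected G₂) {x : Leg G₁.kind} (hx : x ≠ a) :
    ReflTransGen (AdjOff (glue G₁ G₂ a b ha hb hab) (legL G₁.kind G₂.kind x)) (Fin.castAdd G₂.nV i)
        (Fin.natAdd G₁.nV j) ↔ ReflTransGen (AdjOff G₁ x) i a.1 := by
  constructor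
  · intro h
    simpa using proj_left_reflTransGen h
  · intro h
    refine (lift_left_adjOff h).trans ((ReflTransGen.single (adjOff_glue_new ?_ ?_)).trans
      (lift_right (fun y₀ _ => legL_ne_legR _ _ x y₀) (hG₂ b.1 j)))
    · exact fun e => hx (legL_injective _ _ e)
    · exact legL_ne_legR _ _ x b

/-- **… and after cutting an old line of the second piece iff the port `b.1` stays joined to `j` in `G₂`** (first piece
connected). [cite: Balaban1983Higgs3, (1.21) p.416] -/
theorem reach_glue_legR_iff (hG₁ : IsConnected G₁) {y : Leg G₂.kind} (hy : y ≠ b) :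
    ReflTransGen (AdjOff (glue G₁ G₂ a b ha hb hab) (legR G₁.kind G₂.kind y)) (Fin.castAdd G₂.nV i)
        (Fin.natAdd G₁.nV j) ↔ ReflTransGen (AdjOff G₂ y) b.1 j := by
  constructor
  · intro h
    simpa using proj_right_reflTransGen h
  · intro h
    refine (lift_left (fun x₀ _ => (legL_ne_legR _ _ x₀ y).symm) (hG₁ i a.1)).trans
      ((ReflTransGen.single (adjOff_glue_new ?_ ?_)).trans (lift_right_adjOff h))
    · exact (legL_ne_legR _ _ a y).symm
    · exact fun e => hy (legR_injective _ _ e)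

/-- **an old line of the first piece separates the roots of the glued graph iff it separates `i` from the port `a.1` in `G₁`.**
[cite: Balaban1983Higgs3, (1.21) p.416] -/
theorem sep_glue_legL_iff (hG₂ : IsConnected G₂) {x : Leg G₁.kind} (hx : x ≠ a) :
    Sep (glue G₁ G₂ a b ha hb hab) (Fin.castAdd G₂.nV i) (Fin.natAdd G₁.nV j) (legL G₁.kind G₂.kind x) ↔
      Sep G₁ i a.1 x := by
  unfold B3OnePIChainDecomposition.Sep
  rw [reach_glue_legL_iff i j hG₂ hx, glue_other, glueOther_legL_of_ne hx]
  cases G₁.other x <;> simp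

/-- **an old line of the second piece separates the roots of the glued graph iff it separates the port `b.1` from `j` in `G₂`.**
[cite: Balaban1983Higgs3, (1.21) p.416] -/
theorem sep_glue_legR_iff (hG₁ : IsConnected G₁) {y : Leg G₂.kind} (hy : y ≠ b) :
    Sep (glue G₁ G₂ a b ha hb hab) (Fin.castAdd G₂.nV i) (Fin.natAdd G₁.nV j) (legR G₁.kind G₂.kind y) ↔
      Sep G₂ b.1 j y := by
  unfold B3OnePIChainDecomposition.Sep
  rw [reach_glue_legR_iff i j hG₁ hy, glue_other, glueOther_legR_of_ne hy]
  cases G₂.other y <;> simp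

/-- **the new line separates the roots** (p37's `not_reflTransGen_adjOff_glue`), **and its near leg is `legL a`** (first piece
connected). [cite: Balaban1983Higgs3, (1.21) p.416] -/
theorem isNear_glue_new (hG₁ : IsConnected G₁) :
    IsNear (glue G₁ G₂ a b ha hb hab) (Fin.castAdd G₂.nV i) (Fin.natAdd G₁.nV j) (legL G₁.kind G₂.kind a) := by
  refine ⟨⟨?_, not_reflTransGen_adjOff_glue i j⟩, ?_⟩
  · rw [glue_other, glueOther_legL_self]
    rfl
  · have hc : ∀ x₀, (G₁.other x₀).isSome → legL G₁.kind G₂.kind a ≠ legL G₁.kind G₂.kind x₀ := by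
      intro x₀ hx₀ e
      rw [← legL_injective _ _ e, ha] at hx₀
      exact Bool.false_ne_true hx₀
    simpa using lift_left hc (hG₁ i a.1)

/-- kernel: the far leg `legR b` of the new line is not near. [cite: Balaban1983Higgs3, (1.21) p.416] -/
theorem not_isNear_glue_legR_b (hG₁ : IsConnected G₁) (hG₂ : IsConnected G₂) :
    ¬ IsNear (glue G₁ G₂ a b ha hb hab) (Fin.castAdd G₂.nV i) (Fin.natAdd G₁.nV j) (legR G₁.kind G₂.kind b) :=
  (isNear_glue_new i j hG₁).not_isNear_other (isConnected_glue hG₁ hG₂)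
    (by rw [glue_other, glueOther_legL_self])

/-- **near legs of old lines of the first piece correspond** (`x ≠ a`). [cite: Balaban1983Higgs3, (1.21) p.416] -/
theorem isNear_glue_legL_iff (hG₂ : IsConnected G₂) {x : Leg G₁.kind} (hx : x ≠ a) :
    IsNear (glue G₁ G₂ a b ha hb hab) (Fin.castAdd G₂.nV i) (Fin.natAdd G₁.nV j) (legL G₁.kind G₂.kind x) ↔
      IsNear G₁ i a.1 x := by
  unfold IsNear
  rw [sep_glue_legL_iff i j hG₂ hx]
  refine and_congr_right fun _ => ⟨fun h => by simpa using proj_left_reflTransGen h, fun h => ?_⟩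
  simpa using lift_left_adjOff (G₂ := G₂) (a := a) (b := b) (ha := ha) (hb := hb) (hab := hab) h

/-- **near legs of old lines of the second piece correspond** (`y ≠ b`; first piece connected for the lift through the new
line). [cite: Balaban1983Higgs3, (1.21) p.416] -/
theorem isNear_glue_legR_iff (hG₁ : IsConnected G₁) {y : Leg G₂.kind} (hy : y ≠ b) :
    IsNear (glue G₁ G₂ a b ha hb hab) (Fin.castAdd G₂.nV i) (Fin.natAdd G₁.nV j) (legR G₁.kind G₂.kind y) ↔
      IsNear G₂ b.1 j y := by
  unfold IsNear
  rw [sep_glue_legR_iff i j hG₁ hy]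
  refine and_congr_right fun _ => ⟨fun h => by simpa using proj_right_reflTransGen h, fun h => ?_⟩
  have step : ReflTransGen (AdjOff (glue G₁ G₂ a b ha hb hab) (legR G₁.kind G₂.kind y)) (Fin.castAdd G₂.nV i)
      (Fin.natAdd G₁.nV b.1) :=
    (lift_left (fun x₀ _ => (legL_ne_legR _ _ x₀ y).symm) (hG₁ i a.1)).tail
      (adjOff_glue_new (legL_ne_legR _ _ a y).symm (fun e => hy (legR_injective _ _ e)))
  simpa using step.trans (lift_right_adjOff h)

/-- **THE NEAR LEGS OF THE GLUED GRAPH**: the new line's `legL a`, the near legs of `G₁` between `i` and the port `a.1`, and the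
near legs of `G₂` between the port `b.1` and `j` (both pieces connected). [cite: Balaban1983Higgs3, (1.21) p.416] -/
theorem mem_nearLegs_glue (hG₁ : IsConnected G₁) (hG₂ : IsConnected G₂) {c : Leg (Fin.append G₁.kind G₂.kind)} :
    c ∈ nearLegs (glue G₁ G₂ a b ha hb hab) (Fin.castAdd G₂.nV i) (Fin.natAdd G₁.nV j) ↔
      c = legL G₁.kind G₂.kind a ∨ (∃ x ∈ nearLegs G₁ i a.1, c = legL G₁.kind G₂.kind x) ∨
        (∃ y ∈ nearLegs G₂ b.1 j, c = legR G₁.kind G₂.kind y) := by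
  rw [mem_nearLegs]
  rcases exists_legL_or_legR G₁.kind G₂.kind c with ⟨x, rfl⟩ | ⟨y, rfl⟩
  · by_cases hx : x = a
    · subst hx
      simpa using isNear_glue_new i j hG₁
    · rw [isNear_glue_legL_iff i j hG₂ hx]
      constructor
      · intro h
        exact Or.inr (Or.inl ⟨x, mem_nearLegs.2 h, rfl⟩)
      · rintro (e | ⟨x', hx', e⟩ | ⟨y', -, e⟩)
        · exact absurd (legL_injective _ _ e) hx
        · rw [legL_injective _ _ e]
          exact mem_nearLegs.1 hx'
        · exact absurd e (legL_ne_legR _ _ x y')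
  · by_cases hy : y = b
    · constructor
      · intro h
        rw [hy] at h
        exact absurd h (not_isNear_glue_legR_b i j hG₁ hG₂)
      · rintro (e | ⟨x', -, e⟩ | ⟨y', hy', e⟩)
        · exact absurd e.symm (legL_ne_legR _ _ a y)
        · exact absurd e.symm (legL_ne_legR _ _ x' y)
        · have e' : y' = b := (legR_injective _ _ e).symm.trans hy
          have hsome := (mem_nearLegs.1 hy').1.1
          simp [e', hb] at hsome
    · rw [isNear_glue_legR_iff i j hG₁ hy]
      constructor
      · intro h
        exact Or.inr (Or.inr ⟨y, mem_nearLegs.2 h, rfl⟩)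
      · rintro (e | ⟨x', -, e⟩ | ⟨y', hy', e⟩)
        · exact absurd e.symm (legL_ne_legR _ _ a y)
        · exact absurd e.symm (legL_ne_legR _ _ x' y)
        · rw [legR_injective _ _ e]
          exact mem_nearLegs.1 hy'

/-- kernel: the near legs of the glued graph as a finset — `insert (legL a) (map legL (nearLegs G₁ i a.1) ∪ map legR (nearLegs G₂ b.1 j))`.
[cite: Balaban1983Higgs3, (1.21) p.416] -/
theorem nearLegs_glue (hG₁ : IsConnected G₁) (hG₂ : IsConnected G₂) :
    nearLegs (glue G₁ G₂ a b ha hb hab) (Fin.castAdd G₂.nV i) (Fin.natAdd G₁.nV j) =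
      insert (legL G₁.kind G₂.kind a)
        ((nearLegs G₁ i a.1).map ⟨legL G₁.kind G₂.kind, legL_injective _ _⟩ ∪
          (nearLegs G₂ b.1 j).map ⟨legR G₁.kind G₂.kind, legR_injective _ _⟩) := by
  ext c
  rw [mem_nearLegs_glue i j hG₁ hG₂, mem_insert, mem_union, mem_map, mem_map]
  simp only [Function.Embedding.coeFn_mk, eq_comm]

/-- **THE NUMBER OF SEPARATING LINES ADDS UP, PLUS ONE FOR THE NEW LINE**:
`numSep (glue G₁ G₂ a b …) = numSep G₁ i a.1 + numSep G₂ b.1 j + 1` (both pieces connected).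
[cite: Balaban1983Higgs3, (1.21) p.416] -/
theorem numSep_glue (hG₁ : IsConnected G₁) (hG₂ : IsConnected G₂) :
    numSep (glue G₁ G₂ a b ha hb hab) (Fin.castAdd G₂.nV i) (Fin.natAdd G₁.nV j) =
      numSep G₁ i a.1 + numSep G₂ b.1 j + 1 := by
  rw [numSep, nearLegs_glue i j hG₁ hG₂, card_insert_of_notMem, card_union_of_disjoint, card_map, card_map, numSep, numSep]
  · rw [disjoint_left]
    intro c hc₁ hc₂
    obtain ⟨x, -, rfl⟩ := mem_map.1 hc₁
    obtain ⟨y, -, e⟩ := mem_map.1 hc₂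
    exact legL_ne_legR _ _ x y e.symm
  · rw [mem_union, mem_map, mem_map]
    rintro (⟨x, hx, e⟩ | ⟨y, -, e⟩)
    · have hxa : x = a := legL_injective _ _ e
      subst hxa
      exact not_sep_a ha (mem_nearLegs.1 hx).1
    · exact legL_ne_legR _ _ a y e.symm

/-! ## §3 The level function of the glued graph: the levels of `G₁`, then — beyond the new line — those of `G₂` shifted -/

/-- **on the first piece the level is unchanged**: `level (glue …) I J (castAdd v) = level G₁ i a.1 v` — a vertex of `G₁` lies
beyond exactly the (embedded) separating lines of `G₁` it lay beyond; it is on the near side of the new line and of every line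
of `G₂`. [cite: Balaban1983Higgs3, (1.21) p.416] -/
theorem level_glue_left (hG₁ : IsConnected G₁) (hG₂ : IsConnected G₂) (v : Fin G₁.nV) :
    level (glue G₁ G₂ a b ha hb hab) (Fin.castAdd G₂.nV i) (Fin.natAdd G₁.nV j) (Fin.castAdd G₂.nV v) =
      level G₁ i a.1 v := by
  rw [level, level, ← card_map ⟨legL G₁.kind G₂.kind, legL_injective _ _⟩]
  congr 1
  ext c
  rw [mem_beyond, mem_map]
  simp only [Function.Embedding.coeFn_mk, mem_beyond]
  constructor
  · rintro ⟨hc, hcv⟩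
    rcases (mem_nearLegs_glue i j hG₁ hG₂).1 (mem_nearLegs.2 hc) with rfl | ⟨x, hx, rfl⟩ | ⟨y, -, rfl⟩
    · -- the new line: `v` is on its near side
      refine absurd ?_ hcv
      have hcut : ∀ x₀, (G₁.other x₀).isSome → legL G₁.kind G₂.kind a ≠ legL G₁.kind G₂.kind x₀ := by
        intro x₀ hx₀ e
        rw [← legL_injective _ _ e, ha] at hx₀
        exact Bool.false_ne_true hx₀
      exact lift_left hcut (hG₁ i v)
    · have hxa : x ≠ a := by
        rintro rfl
        exact not_sep_a ha (mem_nearLegs.1 hx).1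
      refine ⟨x, ⟨mem_nearLegs.1 hx, fun h => hcv ?_⟩, rfl⟩
      simpa using lift_left_adjOff (G₂ := G₂) (a := a) (b := b) (ha := ha) (hb := hb) (hab := hab) h
    · -- a line of the second piece: `v` is on its near side
      exact absurd (lift_left (fun x₀ _ => (legL_ne_legR _ _ x₀ y).symm) (hG₁ i v)) hcv
  · rintro ⟨x, ⟨hx, hxv⟩, rfl⟩
    have hxa : x ≠ a := by
      rintro rfl
      exact not_sep_a ha hx.1
    refine ⟨(isNear_glue_legL_iff i j hG₂ hxa).2 hx, fun h => hxv ?_⟩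
    simpa using proj_left_reflTransGen h

/-- **on the second piece the level is shifted by the lines of `G₁` and the new line**:
`level (glue …) I J (natAdd w) = numSep G₁ i a.1 + 1 + level G₂ b.1 j w`. [cite: Balaban1983Higgs3, (1.21) p.416] -/
theorem level_glue_right (hG₁ : IsConnected G₁) (hG₂ : IsConnected G₂) (w : Fin G₂.nV) :
    level (glue G₁ G₂ a b ha hb hab) (Fin.castAdd G₂.nV i) (Fin.natAdd G₁.nV j) (Fin.natAdd G₁.nV w) =
      numSep G₁ i a.1 + 1 + level G₂ b.1 j w := by
  classical
  -- `beyond (natAdd w)` = new line ∪ all near legs of `G₁` ∪ the lines of `G₂` that `w` is beyond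
  have hEq : beyond (glue G₁ G₂ a b ha hb hab) (Fin.castAdd G₂.nV i) (Fin.natAdd G₁.nV j) (Fin.natAdd G₁.nV w) =
      insert (legL G₁.kind G₂.kind a)
        ((nearLegs G₁ i a.1).map ⟨legL G₁.kind G₂.kind, legL_injective _ _⟩ ∪
          (beyond G₂ b.1 j w).map ⟨legR G₁.kind G₂.kind, legR_injective _ _⟩) := by
    ext c
    rw [mem_beyond, mem_insert, mem_union, mem_map, mem_map]
    simp only [Function.Embedding.coeFn_mk, mem_beyond]
    constructor
    · rintro ⟨hc, hcw⟩
      rcases (mem_nearLegs_glue i j hG₁ hG₂).1 (mem_nearLegs.2 hc) with rfl | ⟨x, hx, rfl⟩ | ⟨y, hy, rfl⟩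
      · exact Or.inl rfl
      · exact Or.inr (Or.inl ⟨x, hx, rfl⟩)
      · refine Or.inr (Or.inr ⟨y, ⟨mem_nearLegs.1 hy, fun h => hcw ?_⟩, rfl⟩)
        have hyb : y ≠ b := by
          rintro rfl
          exact not_sep_b hb (mem_nearLegs.1 hy).1
        have step : ReflTransGen (AdjOff (glue G₁ G₂ a b ha hb hab) (legR G₁.kind G₂.kind y)) (Fin.castAdd G₂.nV i)
            (Fin.natAdd G₁.nV b.1) :=
          (lift_left (fun x₀ _ => (legL_ne_legR _ _ x₀ y).symm) (hG₁ i a.1)).tail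
            (adjOff_glue_new (legL_ne_legR _ _ a y).symm (fun e => hyb (legR_injective _ _ e)))
        simpa using step.trans (lift_right_adjOff h)
    · rintro (rfl | ⟨x, hx, rfl⟩ | ⟨y, ⟨hy, hyw⟩, rfl⟩)
      · exact ⟨isNear_glue_new i j hG₁, not_reflTransGen_adjOff_glue i w⟩
      · have hxn := mem_nearLegs.1 hx
        have hxa : x ≠ a := by
          rintro rfl
          exact not_sep_a ha hxn.1
        refine ⟨(isNear_glue_legL_iff i j hG₂ hxa).2 hxn, fun h => hxn.1.2 ?_⟩
        simpa using proj_left_reflTransGen h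
      · have hyb : y ≠ b := by
          rintro rfl
          exact not_sep_b hb hy.1
        refine ⟨(isNear_glue_legR_iff i j hG₁ hyb).2 hy, fun h => hyw ?_⟩
        simpa using proj_right_reflTransGen h
  rw [level, hEq, card_insert_of_notMem, card_union_of_disjoint, card_map, card_map, ← numSep, ← level]
  · omega
  · rw [disjoint_left]
    intro c hc₁ hc₂
    obtain ⟨x, -, rfl⟩ := mem_map.1 hc₁
    obtain ⟨y, -, e⟩ := mem_map.1 hc₂
    exact legL_ne_legR _ _ x y e.symm
  · rw [mem_union, mem_map, mem_map]
    rintro (⟨x, hx, e⟩ | ⟨y, -, e⟩)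
    · have hxa : x = a := legL_injective _ _ e
      subst hxa
      exact not_sep_a ha (mem_nearLegs.1 hx).1
    · exact legL_ne_legR _ _ a y e.symm

/-! ## §4 Summary: gluing is concatenation of chains -/

/-- **GLUING CONCATENATES THE CHAINS**: for connected `G₁`, `G₂` glued along one new line between the external legs `a`, `b`,
and roots `I` (a vertex `i` of the first piece), `J` (a vertex `j` of the second): the separating lines of the glued graph are
those of `G₁` between `i` and the port `a.1`, the new line, and those of `G₂` between the port `b.1` and `j`; their number is
`numSep G₁ i a.1 + numSep G₂ b.1 j + 1`; the pieces are the pieces of `G₁` (levels unchanged) followed by the pieces of `G₂`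
(levels shifted by `numSep G₁ i a.1 + 1`) — the vertex-level form of «decompose ∘ glue»: the chain `C₀K₁C₀…K_pC₀` of `G₁` glued
to the chain `C₀K′₁C₀…K′_qC₀` of `G₂` is the chain `C₀K₁…K_p C₀ K′₁…K′_q C₀` (p32's BRICK 2 `List` append).
[cite: Balaban1983Higgs3, (1.21) p.416] -/
theorem chain_glue (hG₁ : IsConnected G₁) (hG₂ : IsConnected G₂) :
    IsConnected (glue G₁ G₂ a b ha hb hab) ∧
    numSep (glue G₁ G₂ a b ha hb hab) (Fin.castAdd G₂.nV i) (Fin.natAdd G₁.nV j) = numSep G₁ i a.1 + numSep G₂ b.1 j + 1 ∧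
    IsNear (glue G₁ G₂ a b ha hb hab) (Fin.castAdd G₂.nV i) (Fin.natAdd G₁.nV j) (legL G₁.kind G₂.kind a) ∧
    level (glue G₁ G₂ a b ha hb hab) (Fin.castAdd G₂.nV i) (Fin.natAdd G₁.nV j) (Fin.castAdd G₂.nV a.1) = numSep G₁ i a.1 ∧
    level (glue G₁ G₂ a b ha hb hab) (Fin.castAdd G₂.nV i) (Fin.natAdd G₁.nV j) (Fin.natAdd G₁.nV b.1) =
      numSep G₁ i a.1 + 1 ∧
    (∀ v, level (glue G₁ G₂ a b ha hb hab) (Fin.castAdd G₂.nV i) (Fin.natAdd G₁.nV j) (Fin.castAdd G₂.nV v) =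
      level G₁ i a.1 v) ∧
    (∀ w, level (glue G₁ G₂ a b ha hb hab) (Fin.castAdd G₂.nV i) (Fin.natAdd G₁.nV j) (Fin.natAdd G₁.nV w) =
      numSep G₁ i a.1 + 1 + level G₂ b.1 j w) := by
  refine ⟨isConnected_glue hG₁ hG₂, numSep_glue i j hG₁ hG₂, isNear_glue_new i j hG₁, ?_, ?_,
    level_glue_left i j hG₁ hG₂, level_glue_right i j hG₁ hG₂⟩
  · rw [level_glue_left i j hG₁ hG₂, level_right]
  · rw [level_glue_right i j hG₁ hG₂, level_left]

/-- **two one-piece graphs glue to a two-piece chain**: if no line of `G₁` separates `i` from the port `a.1` and no line of `G₂`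
separates the port `b.1` from `j` (each piece is a single proper insertion between these ports), the glued graph has exactly ONE
separating line — the new one — with `G₁` as the piece `V_0` and `G₂` as the piece `V_1`: the n = 2 term `C₀ K₁ C₀ K₂ C₀` of (1.21).
[cite: Balaban1983Higgs3, (1.21) p.416] -/
theorem chain_glue_of_one_piece (hG₁ : IsConnected G₁) (hG₂ : IsConnected G₂) (h₁ : numSep G₁ i a.1 = 0)
    (h₂ : numSep G₂ b.1 j = 0) :
    numSep (glue G₁ G₂ a b ha hb hab) (Fin.castAdd G₂.nV i) (Fin.natAdd G₁.nV j) = 1 ∧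
    (∀ v, level (glue G₁ G₂ a b ha hb hab) (Fin.castAdd G₂.nV i) (Fin.natAdd G₁.nV j) (Fin.castAdd G₂.nV v) = 0) ∧
    (∀ w, level (glue G₁ G₂ a b ha hb hab) (Fin.castAdd G₂.nV i) (Fin.natAdd G₁.nV j) (Fin.natAdd G₁.nV w) = 1) := by
  refine ⟨by rw [numSep_glue i j hG₁ hG₂, h₁, h₂], fun v => ?_, fun w => ?_⟩
  · rw [level_glue_left i j hG₁ hG₂]
    have := level_le (i := i) (j := a.1) v
    omega
  · rw [level_glue_right i j hG₁ hG₂, h₁]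
    have := level_le (i := b.1) (j := j) w
    omega

end Roots

end Literature.MathematicalPhysics.QuantumFieldTheory.Balaban1983to89.B3OnePIChainGlueLevels
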